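/-
Copyright (c) 2026. All rights reserved.
Released under Apache 2.0 license as described in the file LICENSE.
Authors: abc-iut cell, wave-4 seat abc-iut-w4-d059 (proof-only; T54-B «T54·hVc-LcFree»: compact `Π^temp_{𝔊,v}`).
-/
import Literature.AnabelianGeometry.SemiGraphs.ArithVertGpNormalizerDictionary
import Literature.AnabelianGeometry.SemiGraphs.ArithLevelDataCptCompact
import HarnessLib

/-!
# [SemiAnbd] Rmk 5.3.1 p. 65: the arithmetic vertex group `Π^temp_{𝔊,v}` is COMPACT — package-free form
# (proof-only; row T54-B, sub-row «T54·hVc-LcFree»)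

Mochizuki, *Semi-graphs of anabelioids*, Publ. RIMS **42** (2006), §5, Rmk 5.3.1 p. 65 ("`Π^temp_{𝔊,v}` …
compact") and the proof of Thm 3.7 (iii) p. 41 [cite: MochizukiSemiAnbd2006, Rmk 5.3.1, p. 65].

PROOF-ONLY (abc-iut cell, row T54-B, seat abc-iut-w4-d059).  abc-iut-w4-d040's `hVc_hBc_of_cosetTowerC` derives
the compactness of `arithVertGp Rc ι v` from a full compact-form package `ArithLevelDataCpt.ofCosetTowerC`, whose
(AI4″) field `stabBranchPairAug` itself consumes `hVc` — so it cannot feed the (AI4″) producer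
(`ArithBranchPairAugChart.lean`).  Here the SAME compactness route (closed stabiliser of finite image along
abc-iut-L3-d2's basis: `IsTempered.isCompact_of_isClosed_of_hasBasis`, abc-iut-w4-d040's `hfin_of_cosetTower`) is run
WITHOUT any package, on abc-iut-w4-d059's dictionary (`ArithVertGpNormalizerDictionary`) at the TREE levels
`K n` (normal, `Φ`-stable, `⋂_n H_w · K_n = H_w` — abc-iut-w4-d085's `hHK`, true at `π₁^temp(𝒢)`:
`piPresentation_hHK`) for representatives matched to the presentation (`hRcV`):
* `mem_arithVertGp_iff_forall_fixes_vMk` — `Π^temp_{𝔊,v₀}` IS the stabiliser of the standard tree vertex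
  `(H_{v₀} · 1 · K_n)_n` (⇐: `Φ_e⁻¹(H) = k_n H k_n⁻¹ ⊆ H · K_n` for every `n`, hence `⊆ H` by `hHK`; with `e⁻¹`);
* `isClosed_arithVertGp` (open action kernels), `isCompact_arithVertGp` (tempered `E`, basis, finite images);
* `hVc_of_cosetTower` — `∀ v, IsCompact (arithVertGp Rc ι v)` from abc-iut-w4-d040's inputs MINUS the package:
  `E` tempered with the basis `levelKer (K n) ⊓ aug⁻¹ U`, `ker aug ≤ range ι`, `Π_A` compact, `hK1′`, `K n` open.
No definition, no new named fact; nothing here takes a side on [IUTchIII] Cor. 3.12.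
-/

namespace Literature.AnabelianGeometry.SemiGraphs

namespace ProfiniteSemiGraph

open CategoryTheory Topology
open scoped Pointwise

universe u v w

variable {𝒢 : ProfiniteSemiGraph.{u}} (c : TemperedPiChart 𝒢)
  (P : SemiGraph.SubgroupPresentation 𝒢.graph c.G)
  {E : Type v} [Group E] {Φ : E →* MulAut c.G} {σ : E →* Aut 𝒢.graph} (hP : P.IsArithCompatible Φ σ)
  (ι : c.G →* E) (hι : Function.Injective ι)
  (hιconj : ∀ (e : E) (x : c.G), e * ι x * e⁻¹ = ι (Φ e x))
  (hιΦ : ∀ g : c.G, Φ (ι g) = MulAut.conj g) (hισ : ∀ g : c.G, σ (ι g) = 1)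
  (hPH : ∀ w, P.H w ∈ verticialSubgroups c w)
  (Rc : ChartRepresentatives c) (hRcV : ∀ v, Rc.Hv v = P.H v)
  (K : ℕ → Subgroup c.G) [∀ n, (K n).Normal] (hKst : ∀ (n : ℕ) (e : E) (x : c.G), x ∈ K n → Φ e x ∈ K n)
  (hHK : ∀ (w : 𝒢.graph.Vertex) (x : c.G), (∀ n, x ∈ (P.H w : Set c.G) * (K n : Set c.G)) → x ∈ P.H w)

/-! ### `Π^temp_{𝔊,v₀}` is the stabiliser of the standard tree vertex -/

include hιΦ hισ hHK in
/-- One inclusion, one element: if `e` fixes the standard class `H_{v₀} · 1 · K_n` at EVERY level, then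
`Φ_e y ∈ H_{v₀}` forces `y ∈ H_{v₀}` (`Φ_e⁻¹(H) = k_n H k_n⁻¹ ⊆ H · K_n`, then `hHK`).
[cite: MochizukiSemiAnbd2006, Rmk 5.3.1, p. 65] -/
theorem mem_H_of_map_mem_of_forall_fixes_vMk {v₀ : 𝒢.graph.Vertex} {e : E}
    (hfix : ∀ n, (P.arithAct hP (K n) (hKst n) e).hom.vertexMap (P.vMk (K n) v₀ 1) = P.vMk (K n) v₀ 1)
    {y : c.G} (hy : Φ e y ∈ P.H v₀) : y ∈ P.H v₀ := by
  refine hHK v₀ y fun n => ?_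
  obtain ⟨hσ, k, hk, hV⟩ := P.exists_mul_inner_isVConj_one_of_fixes_vMk hP (K n) (hKst n) ι hιΦ hισ v₀ e (hfix n)
  have hΦ : Φ (e * ι k) (k⁻¹ * y * k) = Φ e y := by
    rw [map_mul Φ e (ι k), MulAut.mul_apply, hιΦ, MulAut.conj_apply, show k * (k⁻¹ * y * k) * k⁻¹ = y by group]
  have h := hV (k⁻¹ * y * k)
  rw [map_mul σ e (ι k), SemiGraph.aut_mul_vertexMap, hισ, SemiGraph.aut_one_vertexMap, hσ, inv_one, one_mul,
    mul_one, hΦ] at h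
  refine Set.mem_mul.mpr ⟨k⁻¹ * y * k, h.mpr hy, (k⁻¹ * y * k)⁻¹ * y, ?_, by group⟩
  have : (k⁻¹ * y * k)⁻¹ * y = k⁻¹ * (y⁻¹ * k * y) := by group
  rw [this]
  exact (K n).mul_mem ((K n).inv_mem hk) ((inferInstance : (K n).Normal).conj_mem' k hk y)

include hι hιconj hιΦ hισ hPH hRcV hHK in
/-- **`Π^temp_{𝔊,v₀}` IS the stabiliser of the standard tree vertex `(H_{v₀} · 1 · K_n)_n`** (representatives
matched to the presentation, tree levels with `hHK`). [cite: MochizukiSemiAnbd2006, Rmk 5.3.1, p. 65] -/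
theorem mem_arithVertGp_iff_forall_fixes_vMk (h37 : 𝒢.Thm37Hypotheses) {v₀ : 𝒢.graph.Vertex} (e : E) :
    e ∈ arithVertGp Rc ι v₀ ↔
      ∀ n, (P.arithAct hP (K n) (hKst n) e).hom.vertexMap (P.vMk (K n) v₀ 1) = P.vMk (K n) v₀ 1 := by
  constructor
  · intro he n
    exact arithVertGp_fixes_vMk c P hP ι hι hιconj hPH Rc hRcV (K n) (hKst n) hιΦ hισ h37 he
  · intro hfix
    -- `e⁻¹` fixes too
    have hfix' : ∀ n, (P.arithAct hP (K n) (hKst n) e⁻¹).hom.vertexMap (P.vMk (K n) v₀ 1) = P.vMk (K n) v₀ 1 := by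
      intro n
      conv_lhs => rw [← hfix n]
      rw [← SemiGraph.aut_mul_vertexMap, ← map_mul, inv_mul_cancel, map_one]
      rfl
    obtain ⟨hσ, -⟩ := P.exists_mul_inner_isVConj_one_of_fixes_vMk hP (K 0) (hKst 0) ι hιΦ hισ v₀ e (hfix 0)
    refine mem_arithVertGp_of_isVConj_one c P ι hιconj Rc hRcV hσ fun x => ?_
    rw [hσ, inv_one, one_mul, mul_one]
    constructor
    · intro hx
      -- `Φ_{e⁻¹} (Φ_e x) = x ∈ H`
      refine mem_H_of_map_mem_of_forall_fixes_vMk c P hP ι hιΦ hισ K hKst hHK hfix' ?_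
      rw [← MulAut.mul_apply, ← map_mul, inv_mul_cancel, map_one, MulAut.one_apply]
      exact hx
    · exact mem_H_of_map_mem_of_forall_fixes_vMk c P hP ι hιΦ hισ K hKst hHK hfix

/-! ### Closedness and compactness -/

variable [TopologicalSpace E] [IsTopologicalGroup E]

include hι hιconj hιΦ hισ hPH hRcV hHK in
/-- **`Π^temp_{𝔊,v₀}` is CLOSED** when the tree actions have open kernels (a stabiliser of a compatible vertex
system). [cite: MochizukiSemiAnbd2006, Rmk 5.3.1, p. 65] -/
theorem isClosed_arithVertGp (h37 : 𝒢.Thm37Hypotheses)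
    (hKopen : ∀ n, IsOpen ((P.arithAct hP (K n) (hKst n)).ker : Set E)) (v₀ : 𝒢.graph.Vertex) :
    IsClosed ((arithVertGp Rc ι v₀ : Subgroup E) : Set E) := by
  have hset : ((arithVertGp Rc ι v₀ : Subgroup E) : Set E) =
      {e : E | ∀ n, (P.arithAct hP (K n) (hKst n) e).hom.vertexMap (P.vMk (K n) v₀ 1) = P.vMk (K n) v₀ 1} := by
    ext e
    exact mem_arithVertGp_iff_forall_fixes_vMk c P hP ι hι hιconj hιΦ hισ hPH Rc hRcV K hKst hHK h37 e
  rw [hset]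
  exact isClosed_setOf_forall_vertexMap_eq (fun n => P.arithAct hP (K n) (hKst n)) hKopen _

include hι hιconj hιΦ hισ hPH hRcV hHK in
/-- **`Π^temp_{𝔊,v₀}` is COMPACT** in a tempered `E` along a basis `(V i)` of open subgroups modulo which some tree
level has finite vertex stabilisers (abc-iut-w4-d040's input `hfin`). [cite: MochizukiSemiAnbd2006, Rmk 5.3.1, p. 65] -/
theorem isCompact_arithVertGp (h37 : 𝒢.Thm37Hypotheses)
    (hKopen : ∀ n, IsOpen ((P.arithAct hP (K n) (hKst n)).ker : Set E)) (hE : IsTempered E)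
    {ι' : Sort*} {p : ι' → Prop} {V : ι' → Subgroup E} (hb : (𝓝 (1 : E)).HasBasis p (fun i => (V i : Set E)))
    (hfin : ∀ i, p i → ∃ j : ℕ, ∀ x : (P.cosetGraph (K j)).Vertex,
      ((QuotientGroup.mk : E → E ⧸ V i) '' {g : E | (P.arithAct hP (K j) (hKst j) g).hom.vertexMap x = x}).Finite)
    (v₀ : 𝒢.graph.Vertex) : IsCompact ((arithVertGp Rc ι v₀ : Subgroup E) : Set E) := by
  refine hE.isCompact_of_isClosed_of_hasBasis hb
    (isClosed_arithVertGp c P hP ι hι hιconj hιΦ hισ hPH Rc hRcV K hKst hHK h37 hKopen v₀) fun i hi => ?_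
  obtain ⟨j, hj⟩ := hfin i hi
  refine (hj (P.vMk (K j) v₀ 1)).subset (Set.image_mono fun g hg => ?_)
  exact arithVertGp_fixes_vMk c P hP ι hι hιconj hPH Rc hRcV (K j) (hKst j) hιΦ hισ h37 hg

include hι hιconj hιΦ hισ hPH hRcV hHK in
/-- **`hVc` AT A COSET TOWER, package-free** ([SemiAnbd] Rmk 5.3.1 p. 65, "`Π^temp_{𝔊,v}` … compact"): every
`arithVertGp Rc ι v` is compact, modulo exactly abc-iut-w4-d040's inputs (`E` tempered with abc-iut-L3-d2's basis
`levelKer (K n) ⊓ aug⁻¹ U`, `ker aug ≤ range ι`, `Π_A` compact, the continuity binder `hK1′`, the tree levels open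
in `π₁^temp(𝒢)`, open action kernels) and the matching `hRcV` — NO (AI4″)/`hnobp` input.
[cite: MochizukiSemiAnbd2006, Rmk 5.3.1, p. 65] -/
theorem hVc_of_cosetTower (h37 : 𝒢.Thm37Hypotheses)
    (hKopen : ∀ n, IsOpen ((P.arithAct hP (K n) (hKst n)).ker : Set E)) (hE : IsTempered E)
    {PA : Type w} [Group PA] [TopologicalSpace PA] [IsTopologicalGroup PA] [CompactSpace PA] (aug : E →* PA)
    (hb : (𝓝 (1 : E)).HasBasis (fun _ : ℕ × OpenNormalSubgroup PA => True)
      (fun nU => ((P.levelKer hP (K nU.1) (hKst nU.1) ⊓ nU.2.toSubgroup.comap aug : Subgroup E) : Set E)))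
    (hexact : aug.ker ≤ ι.range)
    (hK1' : ∀ n, IsOpen (((P.levelKer hP (K n) (hKst n)).map aug : Subgroup PA) : Set PA))
    (hKopen' : ∀ n, IsOpen (K n : Set c.G)) :
    ∀ v, IsCompact ((arithVertGp Rc ι v : Subgroup E) : Set E) := fun v =>
  isCompact_arithVertGp c P hP ι hι hιconj hιΦ hισ hPH Rc hRcV K hKst hHK h37 hKopen hE hb
    (P.hfin_of_cosetTower hP aug ι hιΦ hισ K hKst hKopen' hexact hK1'
      (fun w => isCompact_of_mem_verticialSubgroups c (hPH w))) v

end ProfiniteSemiGraph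

end Literature.AnabelianGeometry.SemiGraphs
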